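import Summits.PneNP.PneNP.Theorems.ChebyshevTracialDesignBulkScale
import HarnessLib

/-!
# Cell pnp-psdrank, route `ChebyshevTracialDesign`: numeric tools for the asymptotic form of the crossing-plane
# (CG_1′) — brick 126b (crux `TracialDecayExp20`, stmt-PneNP-19878)

Brick 126b (prover g25). Pure real-arithmetic lemmas consumed by brick 126 (`ChebyshevTracialDesignCrossingPlaneExp`),
which turns brick 125's per-matching bound (brick 120's seven remainders with the `x`-smoothness family discharged by the
type, plus the [TAIL] term) into `|PM|·Σ_U W(U,M)·ψ(|U∩H|)·C_u(U)² ≤ 10⁴·(1+B_v)·G·n⁶·e^{−a′D}` for `n ≥ n₀(β, a′)`: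

(the companion `ChebyshevTracialDesignCrossingPlaneRemainder.remainder_le` collapses brick 120's seven remainders)
* §2 `quarter_facts` — the scale `P = n^{1/4}`: `1 ≤ P`, `P⁴ = n`, `√n = P²`, `D⁴ ≤ n ⇒ D ≤ P`.
* §3 **`numerics`** — for `0 < β₀ ≤ 1/8`, `a′ > 0` ONE threshold `P ≥ P*(β₀,a′)` gives the nine polynomial inequalities
  in `(P, D ≤ P, T ≤ 7P²)` used by brick 126 (type margins, the Chernoff window, `T·q ≤ e^{−2a′}` for
  `q = 393216(D+1)/(β₀⁴P⁴)`, the two exponent budgets of the atypical weight, `2D+4 ≤ n/4`, `4D+11 ≤ n`).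
* §4 `pow_pred_le_exp`, `four_pow_mul_exp_le`, `mul_pow_four_pow_mul_exp_le`, `chernoff_exponent_le` — the four
  exponential comparisons (`q^{D−1} ≤ e^{−a′D}` from `q ≤ e^{−2a′}`, `D ≥ 2`; `4^{D+1}e^{−E} ≤ e^{−a′D}`;
  `(4T)^{D+1}e^{−E} ≤ e^{−a′D}`; the Chernoff exponent of brick 125 is `≤ −β₀n/64` in the non-aligned window).
READING: bookkeeping only. WHAT THIS FILE DOES NOT DO: anything combinatorial; anything on `TracialDecayExp20` itself,
psd rank of P_PM(K_n), or P vs NP. [cite: Rothvoss2017, §2 (PDF p. 6)] [cite: RollinRoss2010, §4.1 Thm 4.2]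
[cite: Durrett2019, §2.7]
Stature: support/instrument (kernel lane, no defs, axioms standard). Supports stmt-PneNP-19878.
-/

set_option linter.dupNamespace false -- `Summit.PneNP.PneNP.…`: summit = sub-problem (D-0017)

noncomputable section

namespace Summit.PneNP.PneNP.Theorems.ChebyshevTracialDesignCrossingPlaneExpTools

open Real

/-! ### §2 The scale `P = n^{1/4}` -/

/-- **The quarter scale.** For `n ≥ 1` and `P = n^{1/4}`: `1 ≤ P`, `P⁴ = n`, `√n = P²`, and `D⁴ ≤ n ⇒ D ≤ P` for `D ≥ 0`.
[cite: RollinRoss2010, §4.1 Thm 4.2] -/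
theorem quarter_facts {n : ℝ} (hn : 1 ≤ n) :
    1 ≤ n ^ ((4 : ℕ) : ℝ)⁻¹ ∧ (n ^ ((4 : ℕ) : ℝ)⁻¹) ^ 4 = n ∧ Real.sqrt n = (n ^ ((4 : ℕ) : ℝ)⁻¹) ^ 2 ∧
      ∀ D : ℝ, 0 ≤ D → D ^ 4 ≤ n → D ≤ n ^ ((4 : ℕ) : ℝ)⁻¹ := by
  set P := n ^ ((4 : ℕ) : ℝ)⁻¹ with hP
  have hn0 : 0 ≤ n := by linarith
  have hP4 : P ^ 4 = n := Real.rpow_inv_natCast_pow hn0 (by norm_num)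
  have hP1 : 1 ≤ P := Real.one_le_rpow hn (by positivity)
  have hP0 : 0 ≤ P := by linarith
  have hsqrt : Real.sqrt n = P ^ 2 := by
    rw [← hP4, show P ^ 4 = (P ^ 2) ^ 2 by ring, Real.sqrt_sq (by positivity)]
  refine ⟨hP1, hP4, hsqrt, fun D hD0 hD4 => ?_⟩
  rw [← hP4] at hD4
  exact le_of_pow_le_pow_left₀ (by norm_num) hP0 hD4

/-! ### §3 One threshold for all the numeric inequalities -/

/-- `c ≤ c′·P` once `P ≥ c/c′` (`c ≥ 0`, `c′ > 0`). [cite: RollinRoss2010, §4.1 Thm 4.2] -/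
theorem le_mul_of_threshold {c c' P : ℝ} (hc' : 0 < c') (hP : c / c' ≤ P) : c ≤ c' * P := by
  have := mul_le_mul_of_nonneg_left hP hc'.le
  rwa [mul_div_cancel₀ _ hc'.ne'] at this

/-- `P ≤ P² ≤ P³` for `P ≥ 1`. [cite: RollinRoss2010, §4.1 Thm 4.2] -/
theorem pow_facts {P : ℝ} (hP1 : 1 ≤ P) : P ≤ P ^ 2 ∧ P ^ 2 ≤ P ^ 3 ∧ P ≤ P ^ 3 := by
  have hP0 : 0 ≤ P := by linarith
  have h1 : P ≤ P ^ 2 := by nlinarith [mul_nonneg hP0 (show 0 ≤ P - 1 by linarith)]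
  have h2 : P ^ 2 ≤ P ^ 3 := by nlinarith [mul_nonneg (sq_nonneg P) (show 0 ≤ P - 1 by linarith)]
  exact ⟨h1, h2, h1.trans h2⟩

/-- (1)/(3) `2D+1 ≤ 3P³ ≤ c′P⁴` once `P ≥ 3/c′`. [cite: RollinRoss2010, §4.1 Thm 4.2] -/
theorem num_lin {c' P D : ℝ} (hc' : 0 < c') (hP : 3 / c' ≤ P) (hP1 : 1 ≤ P) (hDP : D ≤ P) :
    2 * D + 1 ≤ c' * P ^ 4 := by
  have h := le_mul_of_threshold (P := P) hc' hP
  obtain ⟨-, -, hP33⟩ := pow_facts hP1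
  have h3 : 2 * D + 1 ≤ 3 * P ^ 3 := by linarith
  have hP4 : P ^ 4 = P * P ^ 3 := by ring
  rw [hP4]; nlinarith [mul_le_mul_of_nonneg_right h (show 0 ≤ P ^ 3 by positivity)]

/-- (2) `2T+4D+10 ≤ 28P³ ≤ β₀P⁴/4` once `P ≥ 112/β₀`. [cite: RollinRoss2010, §4.1 Thm 4.2] -/
theorem num_two {β₀ P D T : ℝ} (hβ₀ : 0 < β₀) (hP : 112 / β₀ ≤ P) (hP1 : 1 ≤ P) (hDP : D ≤ P)
    (hTP : T ≤ 7 * P ^ 2) : 2 * T + 4 * D + 10 ≤ β₀ * P ^ 4 / 4 := by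
  have h := le_mul_of_threshold (P := P) hβ₀ hP
  obtain ⟨hP2, hP3, hP33⟩ := pow_facts hP1
  have : 2 * T + 4 * D + 10 ≤ 28 * P ^ 3 := by linarith
  have hP4 : P ^ 4 = P * P ^ 3 := by ring
  rw [hP4]; nlinarith [mul_le_mul_of_nonneg_right h (show 0 ≤ P ^ 3 by positivity)]

/-- (4) `T+2 ≤ 9P³ ≤ P⁴/32` once `P ≥ 288`. [cite: RollinRoss2010, §4.1 Thm 4.2] -/
theorem num_four {P T : ℝ} (hP : 288 ≤ P) (hTP : T ≤ 7 * P ^ 2) : T + 2 ≤ P ^ 4 / 32 := by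
  have hP1 : 1 ≤ P := by linarith
  obtain ⟨hP2, hP3, hP33⟩ := pow_facts hP1
  have : T + 2 ≤ 9 * P ^ 3 := by linarith
  have hP4 : P ^ 4 = P * P ^ 3 := by ring
  rw [hP4]; nlinarith [mul_le_mul_of_nonneg_right hP (show 0 ≤ P ^ 3 by positivity)]

/-- (5) `7P²·393216(D+1)/(β₀⁴P⁴) ≤ 5505024/(β₀⁴P) ≤ ε` once `P ≥ 5505024/(β₀⁴ε)`. [cite: RollinRoss2010, §4.1 Thm 4.2] -/
theorem num_five {β₀ ε P D : ℝ} (hβ₀ : 0 < β₀) (hε : 0 < ε) (hP : 5505024 / (β₀ ^ 4 * ε) ≤ P) (hP1 : 1 ≤ P)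
    (hD0 : 0 ≤ D) (hDP : D ≤ P) : 7 * P ^ 2 * (393216 * (D + 1) / (β₀ ^ 4 * P ^ 4)) ≤ ε := by
  have hβ₀4 : 0 < β₀ ^ 4 := by positivity
  have h := le_mul_of_threshold (P := P) (by positivity) hP
  have hP0 : 0 < P := by linarith
  rw [show 7 * P ^ 2 * (393216 * (D + 1) / (β₀ ^ 4 * P ^ 4)) =
    2752512 * (D + 1) / (β₀ ^ 4 * P ^ 2) by field_simp; ring]
  rw [div_le_iff₀ (by positivity)]
  have h2 : (D + 1) ≤ 2 * P := by linarith
  nlinarith [mul_le_mul_of_nonneg_right h hP0.le, mul_nonneg hβ₀4.le hε.le,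
    mul_le_mul_of_nonneg_left h2 (show 0 ≤ (2752512 : ℝ) by norm_num)]

/-- (7) `2(D+1) + a′D ≤ (4+a′)P³ ≤ β₀P⁴/64` once `P ≥ 64(4+a′)/β₀`. [cite: RollinRoss2010, §4.1 Thm 4.2] -/
theorem num_seven {β₀ a' P D : ℝ} (hβ₀ : 0 < β₀) (ha' : 0 ≤ a') (hP : 64 * (4 + a') / β₀ ≤ P) (hP1 : 1 ≤ P)
    (hDP : D ≤ P) : 2 * (D + 1) + a' * D ≤ β₀ * P ^ 4 / 64 := by
  have h := le_mul_of_threshold (P := P) hβ₀ hP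
  obtain ⟨hP2, hP3, hP33⟩ := pow_facts hP1
  have : 2 * (D + 1) + a' * D ≤ (4 + a') * P ^ 3 := by
    have : a' * D ≤ a' * P ^ 3 := mul_le_mul_of_nonneg_left (hDP.trans hP33) ha'
    nlinarith
  have hP4 : P ^ 4 = P * P ^ 3 := by ring
  rw [hP4]; nlinarith [mul_le_mul_of_nonneg_right h (show 0 ≤ P ^ 3 by positivity)]

/-- (8) `(D+1)·28P² + a′D ≤ (56+a′)P³ ≤ β₀P⁴/64` once `P ≥ 64(56+a′)/β₀`. [cite: RollinRoss2010, §4.1 Thm 4.2] -/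
theorem num_eight {β₀ a' P D : ℝ} (hβ₀ : 0 < β₀) (ha' : 0 ≤ a') (hP : 64 * (56 + a') / β₀ ≤ P) (hP1 : 1 ≤ P)
    (hDP : D ≤ P) : (D + 1) * (4 * (7 * P ^ 2)) + a' * D ≤ β₀ * P ^ 4 / 64 := by
  have h := le_mul_of_threshold (P := P) hβ₀ hP
  obtain ⟨hP2, hP3, hP33⟩ := pow_facts hP1
  have : (D + 1) * (4 * (7 * P ^ 2)) + a' * D ≤ (56 + a') * P ^ 3 := by
    have : a' * D ≤ a' * P ^ 3 := mul_le_mul_of_nonneg_left (hDP.trans hP33) ha'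
    have : (D + 1) * P ^ 2 ≤ 2 * P * P ^ 2 := mul_le_mul_of_nonneg_right (by linarith) (by positivity)
    nlinarith
  have hP4 : P ^ 4 = P * P ^ 3 := by ring
  rw [hP4]; nlinarith [mul_le_mul_of_nonneg_right h (show 0 ≤ P ^ 3 by positivity)]

/-- (9) `4D+11 ≤ 15P³ ≤ P⁴` once `P ≥ 15`. [cite: RollinRoss2010, §4.1 Thm 4.2] -/
theorem num_nine {P D : ℝ} (hP : 15 ≤ P) (hDP : D ≤ P) : 4 * D + 11 ≤ P ^ 4 := by
  have hP1 : 1 ≤ P := by linarith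
  obtain ⟨hP2, hP3, hP33⟩ := pow_facts hP1
  have : 4 * D + 11 ≤ 15 * P ^ 3 := by linarith
  have hP4 : P ^ 4 = P * P ^ 3 := by ring
  rw [hP4]; nlinarith [mul_le_mul_of_nonneg_right hP (show 0 ≤ P ^ 3 by positivity)]

/-- **The numerics of brick 126.** For `0 < β₀ ≤ 1/8` and `a′ > 0` there is `P* ≥ 1` such that for all `P ≥ P*`, all
`1 ≤ D ≤ P` and `0 ≤ T ≤ 7P²`: (1) `2D+1 ≤ β₀P⁴/8`; (2) `2T+4D+10 ≤ β₀P⁴/4`; (3) `2D+1 ≤ β₀⁴P⁴/64`; (4) `T+2 ≤ P⁴/32`;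
(5) `7P²·(393216(D+1)/(β₀⁴P⁴)) ≤ e^{−2a′}`; (6) `393216(D+1)/(β₀⁴P⁴) ≤ e^{−2a′}`; (7) `2(D+1) + a′D ≤ β₀P⁴/64`;
(8) `(D+1)·(4·(7P²)) + a′D ≤ β₀P⁴/64`; (9) `4D+11 ≤ P⁴`. [cite: RollinRoss2010, §4.1 Thm 4.2] -/
theorem numerics {β₀ a' : ℝ} (hβ₀ : 0 < β₀) (hβ₀8 : β₀ ≤ 1 / 8) (ha' : 0 < a') :
    ∃ Pstar : ℝ, 1 ≤ Pstar ∧ ∀ P : ℝ, Pstar ≤ P → ∀ D T : ℝ, 1 ≤ D → D ≤ P → 0 ≤ T → T ≤ 7 * P ^ 2 →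
      2 * D + 1 ≤ β₀ * P ^ 4 / 8 ∧
      2 * T + 4 * D + 10 ≤ β₀ * P ^ 4 / 4 ∧
      2 * D + 1 ≤ β₀ ^ 4 * P ^ 4 / 64 ∧
      T + 2 ≤ P ^ 4 / 32 ∧
      7 * P ^ 2 * (393216 * (D + 1) / (β₀ ^ 4 * P ^ 4)) ≤ Real.exp (-(2 * a')) ∧
      393216 * (D + 1) / (β₀ ^ 4 * P ^ 4) ≤ Real.exp (-(2 * a')) ∧
      2 * (D + 1) + a' * D ≤ β₀ * P ^ 4 / 64 ∧
      (D + 1) * (4 * (7 * P ^ 2)) + a' * D ≤ β₀ * P ^ 4 / 64 ∧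
      4 * D + 11 ≤ P ^ 4 := by
  have hε : 0 < Real.exp (-(2 * a')) := Real.exp_pos _
  have hβ₀4 : 0 < β₀ ^ 4 := by positivity
  set A1 := 3 / (β₀ / 8) with hA1
  set A2 := 112 / β₀ with hA2
  set A3 := 3 / (β₀ ^ 4 / 64) with hA3
  set A5 := 5505024 / (β₀ ^ 4 * Real.exp (-(2 * a'))) with hA5
  set A7 := 64 * (4 + a') / β₀ with hA7
  set A8 := 64 * (56 + a') / β₀ with hA8
  have t1 : 0 ≤ A1 := by positivity
  have t2 : 0 ≤ A2 := by positivity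
  have t3 : 0 ≤ A3 := by positivity
  have t5 : 0 ≤ A5 := by positivity
  have t7 : 0 ≤ A7 := by positivity
  have t8 : 0 ≤ A8 := by positivity
  refine ⟨288 + A1 + A2 + A3 + A5 + A7 + A8, by linarith, ?_⟩
  intro P hP D T hD1 hDP hT0 hTP
  have hP1 : 1 ≤ P := by linarith
  have hD0 : 0 ≤ D := by linarith
  have c1 : 2 * D + 1 ≤ β₀ * P ^ 4 / 8 := by
    have := num_lin (c' := β₀ / 8) (by positivity) (by linarith) hP1 hDP; linarith
  have c3 : 2 * D + 1 ≤ β₀ ^ 4 * P ^ 4 / 64 := by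
    have := num_lin (c' := β₀ ^ 4 / 64) (by positivity) (by linarith) hP1 hDP; linarith
  have c5 := num_five hβ₀ hε (by linarith) hP1 hD0 hDP
  have c6 : 393216 * (D + 1) / (β₀ ^ 4 * P ^ 4) ≤ Real.exp (-(2 * a')) := by
    refine le_trans ?_ c5
    have hx : 0 ≤ 393216 * (D + 1) / (β₀ ^ 4 * P ^ 4) := by positivity
    have h7 : (1 : ℝ) ≤ 7 * P ^ 2 := by nlinarith
    nlinarith
  exact ⟨c1, num_two hβ₀ (by linarith) hP1 hDP hTP, c3, num_four (by linarith) hTP, c5, c6,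
    num_seven hβ₀ ha'.le (by linarith) hP1 hDP, num_eight hβ₀ ha'.le (by linarith) hP1 hDP,
    num_nine (by linarith) hDP⟩

/-! ### §4 Exponential comparisons -/

/-- `q^{D−1} ≤ e^{−a′D}` for `0 ≤ q ≤ e^{−2a′}`, `D ≥ 2`, `a′ ≥ 0`. [cite: Durrett2019, §2.7] -/
theorem pow_pred_le_exp {q a' : ℝ} {D : ℕ} (hq0 : 0 ≤ q) (hq : q ≤ Real.exp (-(2 * a'))) (ha' : 0 ≤ a')
    (hD : 2 ≤ D) : q ^ (D - 1) ≤ Real.exp (-(a' * D)) := by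
  calc q ^ (D - 1) ≤ (Real.exp (-(2 * a'))) ^ (D - 1) := pow_le_pow_left₀ hq0 hq _
    _ = Real.exp (((D - 1 : ℕ) : ℝ) * (-(2 * a'))) := (Real.exp_nat_mul _ _).symm
    _ ≤ Real.exp (-(a' * D)) := by
        refine Real.exp_le_exp.2 ?_
        have hD' : ((D - 1 : ℕ) : ℝ) = (D : ℝ) - 1 := by
          rw [Nat.cast_sub (by omega)]; simp
        rw [hD']
        have : (2 : ℝ) ≤ D := by exact_mod_cast hD
        nlinarith

/-- `4^{D+1}·e^{−E} ≤ e^{−a′D}` once `2(D+1) + a′D ≤ E` (`log 4 ≤ 2`). [cite: Durrett2019, §2.7] -/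
theorem four_pow_mul_exp_le {E a' : ℝ} {D : ℕ} (h : 2 * ((D : ℝ) + 1) + a' * D ≤ E) :
    (4 : ℝ) ^ (D + 1) * Real.exp (-E) ≤ Real.exp (-(a' * D)) := by
  have hlog4 : Real.log 4 ≤ 2 := by
    rw [show (4 : ℝ) = 2 ^ 2 by norm_num, Real.log_pow]
    have := Real.log_two_lt_d9; push_cast; linarith
  have h4 : (4 : ℝ) ^ (D + 1) = Real.exp (((D + 1 : ℕ) : ℝ) * Real.log 4) := by
    rw [Real.exp_nat_mul, Real.exp_log (by norm_num)]
  rw [h4, ← Real.exp_add]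
  refine Real.exp_le_exp.2 ?_
  have : ((D + 1 : ℕ) : ℝ) * Real.log 4 ≤ 2 * ((D : ℝ) + 1) := by
    push_cast; nlinarith [Real.log_nonneg (show (1:ℝ) ≤ 4 by norm_num)]
  linarith

/-- `T^{D+1}·4^{D+1}·e^{−E} ≤ e^{−a′D}` once `(D+1)·(4T) + a′D ≤ E`, `T > 0` (`log(4T) ≤ 4T`). [cite: Durrett2019, §2.7] -/
theorem mul_pow_four_pow_mul_exp_le {E a' T : ℝ} {D : ℕ} (hT : 0 < T) (h : ((D : ℝ) + 1) * (4 * T) + a' * D ≤ E) :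
    T ^ (D + 1) * (4 : ℝ) ^ (D + 1) * Real.exp (-E) ≤ Real.exp (-(a' * D)) := by
  have h4T : 0 < 4 * T := by positivity
  have hlog : Real.log (4 * T) ≤ 4 * T := by
    have := Real.log_le_sub_one_of_pos h4T; linarith
  have h1 : T ^ (D + 1) * (4 : ℝ) ^ (D + 1) = Real.exp (((D + 1 : ℕ) : ℝ) * Real.log (4 * T)) := by
    rw [Real.exp_nat_mul, Real.exp_log h4T, mul_pow]; ring
  rw [h1, ← Real.exp_add]
  refine Real.exp_le_exp.2 ?_
  have : ((D + 1 : ℕ) : ℝ) * Real.log (4 * T) ≤ ((D : ℝ) + 1) * (4 * T) := by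
    push_cast; exact mul_le_mul_of_nonneg_left hlog (by positivity)
  linarith

/-- **The Chernoff exponent in the non-aligned window.** With `u = β₀ ≤ 1/8`, `a ≤ N/2 − β₀N` (so `a ≥ 0` is not needed), `T + 2 ≤ β₀N`,
`T + 2 ≤ N/16`, `N/2 ≤ t`, `r₀ < β₀N/2 + 1`:
`(u+u²)·(t/2)·a/(N−T−2) − u·((t−T−2)/2 + 1 − r₀) ≤ −β₀N/32`. [cite: Durrett2019, §2.7] -/
theorem chernoff_exponent_le {β₀ a N T tt r₀ : ℝ} (hβ₀ : 0 < β₀) (hβ₀8 : β₀ ≤ 1 / 8)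
    (ha : a ≤ N / 2 - β₀ * N) (hT0 : 0 ≤ T) (hT : T + 2 ≤ β₀ * N) (hT' : T + 2 ≤ N / 16) (htt : N / 2 ≤ tt)
    (hr₀ : r₀ < β₀ * N / 2 + 1) :
    (β₀ + β₀ ^ 2) * (tt / 2 * a / (N - T - 2)) - β₀ * ((tt - T - 2) / 2 + 1 - r₀) ≤ -(β₀ * N / 32) := by
  have hN : 0 < N - T - 2 := by nlinarith
  have htt0 : 0 ≤ tt := by nlinarith
  -- `a/(N−T−2) ≤ 1/2 − β₀/2`
  have hA : a / (N - T - 2) ≤ 1 / 2 - β₀ / 2 := by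
    rw [div_le_iff₀ hN]; nlinarith
  have hZ : tt / 2 * a / (N - T - 2) ≤ tt / 2 * (1 / 2 - β₀ / 2) := by
    rw [mul_div_assoc]; exact mul_le_mul_of_nonneg_left hA (by positivity)
  have h1 : (β₀ + β₀ ^ 2) * (tt / 2 * a / (N - T - 2)) ≤ (β₀ + β₀ ^ 2) * (tt / 2 * (1 / 2 - β₀ / 2)) :=
    mul_le_mul_of_nonneg_left hZ (by positivity)
  have h2 : β₀ * ((tt - T - 2) / 2 - β₀ * N / 2) ≤ β₀ * ((tt - T - 2) / 2 + 1 - r₀) :=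
    mul_le_mul_of_nonneg_left (by linarith) hβ₀.le
  have h3 : 0 ≤ β₀ ^ 3 * tt := by positivity
  have h4 : β₀ * (β₀ * N / 2) ≤ β₀ * (N / 16) := mul_le_mul_of_nonneg_left (by nlinarith) hβ₀.le
  have h5 : β₀ * (T + 2) ≤ β₀ * (N / 16) := mul_le_mul_of_nonneg_left hT' hβ₀.le
  have h6 : β₀ * (N / 2) ≤ β₀ * tt := mul_le_mul_of_nonneg_left htt hβ₀.le
  nlinarith

end Summit.PneNP.PneNP.Theorems.ChebyshevTracialDesignCrossingPlaneExpTools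

end
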